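import Literature.IUT.LogVolume.IsometryMoverAscent
import Literature.IUT.LogVolume.WildQuadraticIsometryMover
import HarnessLib

/-!
# Maximal-order movers WITHOUT degree condition: every `3`-adic field containing `∛3`, every `2`-adic field
# containing `√2`, carries a `ℚ_p`-linear isometry moving `(R_I)^∼`

Classical local algebra (nothing disputed; the [IUTchIV] locator records where the abc-iut cell uses it).  The tree's
two explicit maximal-order movers are stated at the exhibit fields themselves — `WildCubicIsometryMover.exists_isometry_
maxOrder_mover` needs `[K : ℚ₃] = 3` with `π³ = 3`, `WildQuadratic.exists_isometry_maxOrder_mover` needs `[K : ℚ₂] = 2` with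
`π² = 2`.  By the ascent lemma `exists_isometry_mover_pair_of_subfield` (`IsometryMoverAscent`: orthogonal complements
over `ℚ_p`, injective packet morphisms reflect `(R_I)^∼`) the degree conditions DROP: it suffices that `K` CONTAINS a root,
the exhibit living on the subfield `ℚ_p(π) = ℚ_[p]⟮π⟯ ⊆ K` (Mathlib `IntermediateField.adjoin`, which inherits the four
instances of the cell's setting; its degree is `3`, resp. `2`: `≤` because the minimal polynomial divides `X³ − 3`, resp.
`X² − 2`, `≥` by abc-iut-S1's / abc-iut-E-t16's norm-based linear independence of `1, π, π²`, resp. `1, π` — the argument of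
`exists_wildCubic_subfield` / `exists_wildQuadratic_subfield`, run inside an arbitrary `K` instead of `ℚ̄_p`).

* `finrank_adjoin_cubeRoot_three`, `finrank_adjoin_sqrt_two` — `[ℚ₃(π) : ℚ₃] = 3` (`π³ = 3`), `[ℚ₂(π) : ℚ₂] = 2` (`π² = 2`)
  for `π` in ANY normed field extension `K` of `ℚ_p`;
* **`exists_isometry_maxOrder_mover_of_cubeRoot`** — `K ∋ π`, `π³ = 3` (any degree): there are a `ℚ₃`-linear ISOMETRY `G` of
  `K` (mapping `𝒪_K` and every `𝔪_K^n` onto themselves) and `z ∈ (R_I)^∼` of `K ⊗_{ℚ₃} K` with `(G ⊗ 1) z ∉ (R_I)^∼`;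
* **`exists_isometry_maxOrder_mover_of_sqrtTwo`** — the same over `ℚ₂` for `K ∋ π`, `π² = 2`.

Use (abc-iut cell, R-J row Y-29b, rider R2): the binder-free instance theorems of `Joshi/TestRealPinsMaxOrderMoverAscent`.
Statement about CONTAINERS only; it takes no side on [IUTchIII] Cor. 3.12.  PROOF-ONLY file (theorems, no definitions).
[cite: Mochizuki2012, IUTchIV Prop. 1.1 p. 9] [cite: NeukirchANT1999, Ch. II (5.5)] [cite: WeilBNT1967, Ch. II §1, Prop. 2–3]
-/

noncomputable section

open Metric Set Module Polynomial IntermediateField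
open scoped TensorProduct

namespace Literature.IUT.LogVolume

/-! ## `[ℚ₃(π) : ℚ₃] = 3` for `π³ = 3`, inside any `K` -/

section Cubic

variable {K : Type} [NontriviallyNormedField K] [NormedAlgebra ℚ_[3] K] [IsUltrametricDist K]

omit [IsUltrametricDist K] in
/-- `π³ = 3` ⇒ `π` is integral over `ℚ₃` (root of `X³ − 3`). [cite: NeukirchANT1999, Ch. II (5.5)] -/
theorem aeval_X_pow_three_sub_C_eq_zero {π : K} (hπ : π ^ 3 = 3) :
    Polynomial.aeval π (X ^ 3 - C (3 : ℚ_[3])) = 0 := by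
  have h3 : algebraMap ℚ_[3] K 3 = 3 := map_ofNat _ 3
  simp [hπ, h3]

/-- **`[ℚ₃(π) : ℚ₃] = 3`** for `π ∈ K` with `π³ = 3`, `K` any ultrametric normed field over `ℚ₃`: `≤ 3` since the minimal
polynomial divides `X³ − 3`, `≥ 3` since `1, π, π²` are linearly independent (their norms lie in distinct classes modulo
`3^ℤ`, abc-iut-S1's `WildCubic.linearIndependent_one_pi_pi_sq`, applied inside the subfield). [cite: NeukirchANT1999, Ch. II (5.5)] -/
theorem finrank_adjoin_cubeRoot_three {π : K} (hπ : π ^ 3 = 3) :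
    Module.finrank ℚ_[3] ℚ_[3]⟮π⟯ = 3 ∧ (⟨π, mem_adjoin_simple_self ℚ_[3] π⟩ : ℚ_[3]⟮π⟯) ^ 3 = 3 := by
  have heval := aeval_X_pow_three_sub_C_eq_zero hπ
  have hint : IsIntegral ℚ_[3] π := ⟨X ^ 3 - C 3, monic_X_pow_sub_C 3 (by norm_num), by
    simpa [Polynomial.aeval_def] using heval⟩
  haveI hfd : FiniteDimensional ℚ_[3] ℚ_[3]⟮π⟯ := adjoin.finiteDimensional hint
  have hπE : (⟨π, mem_adjoin_simple_self ℚ_[3] π⟩ : ℚ_[3]⟮π⟯) ^ 3 = 3 := by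
    apply Subtype.ext
    have h3E : ((3 : ℚ_[3]⟮π⟯) : K) = 3 := map_ofNat (algebraMap ℚ_[3]⟮π⟯ K) 3
    simp [hπ, h3E]
  refine ⟨le_antisymm ?_ ?_, hπE⟩
  · rw [adjoin.finrank hint]
    have hdvd : minpoly ℚ_[3] π ∣ X ^ 3 - C 3 := minpoly.dvd ℚ_[3] π heval
    have hne : (X ^ 3 - C (3 : ℚ_[3])) ≠ 0 := (monic_X_pow_sub_C 3 (by norm_num)).ne_zero
    calc (minpoly ℚ_[3] π).natDegree ≤ (X ^ 3 - C (3 : ℚ_[3])).natDegree := natDegree_le_of_dvd hdvd hne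
      _ = 3 := natDegree_X_pow_sub_C
  · have hli := WildCubic.linearIndependent_one_pi_pi_sq (K := ℚ_[3]⟮π⟯) hπE
    simpa using hli.fintype_card_le_finrank

/-- **WILD CUBIC MOVER WITHOUT DEGREE CONDITION.**  For ANY `3`-adic field `K` (ultrametric, proper) containing `π` with
`π³ = 3` there are a `ℚ₃`-linear ISOMETRY `G` of `K` (`‖G x‖ = ‖x‖`, so `G(𝒪_K) = 𝒪_K` and `G(𝔪_K^n) = 𝔪_K^n`) and a point `z`
of the maximal order `(R_I)^∼` of `K ⊗_{ℚ₃} K` with `(G ⊗ 1) z ∉ (R_I)^∼`: the reflection mover of `ℚ₃(π)`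
(`exists_isometry_maxOrder_mover`) ascends along `ℚ₃(π) ⊆ K` (`exists_isometry_mover_pair_of_subfield`).
[cite: Mochizuki2012, IUTchIV Prop. 1.1 p. 9] [cite: NeukirchANT1999, Ch. II (5.5)] [cite: WeilBNT1967, Ch. II §1, Prop. 2–3] -/
theorem exists_isometry_maxOrder_mover_of_cubeRoot [ProperSpace K] {π : K} (hπ : π ^ 3 = 3) :
    ∃ G : K ≃ₗ[ℚ_[3]] K, (∀ x, ‖G x‖ = ‖x‖) ∧ (∀ r : ℝ, G '' closedBall (0 : K) r = closedBall 0 r) ∧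
      ∃ z : PacketAlgebra 3 (fun _ : Fin 2 => K),
        z ∈ (normalizedPacket 3 (fun _ : Fin 2 => K) : Set (PacketAlgebra 3 (fun _ : Fin 2 => K))) ∧
          (PiTensorProduct.congr (![G, LinearEquiv.refl ℚ_[3] K] : ∀ _ : Fin 2, K ≃ₗ[ℚ_[3]] K) :
              PacketAlgebra 3 (fun _ : Fin 2 => K) ≃ₗ[ℚ_[3]] PacketAlgebra 3 (fun _ : Fin 2 => K)) z ∉
            (normalizedPacket 3 (fun _ : Fin 2 => K) : Set (PacketAlgebra 3 (fun _ : Fin 2 => K))) := by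
  obtain ⟨hK₀, hπ₀⟩ := finrank_adjoin_cubeRoot_three hπ
  haveI : FiniteDimensional ℚ_[3] ℚ_[3]⟮π⟯ := Module.finite_of_finrank_eq_succ hK₀
  haveI : ProperSpace ℚ_[3]⟮π⟯ := FiniteDimensional.proper ℚ_[3] ℚ_[3]⟮π⟯
  obtain ⟨g, hg, -, z, hz, hmv⟩ := exists_isometry_maxOrder_mover (K := ℚ_[3]⟮π⟯) hK₀ hπ₀
  obtain ⟨G, hGn, hGball, -, z', hz', hmv'⟩ :=
    exists_isometry_mover_pair_of_subfield 3 (ℚ_[3]⟮π⟯).val g hg hz hmv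
  exact ⟨G, hGn, hGball, z', hz', hmv'⟩

end Cubic

/-! ## `[ℚ₂(π) : ℚ₂] = 2` for `π² = 2`, inside any `K` -/

section Quadratic

variable {K : Type} [NontriviallyNormedField K] [NormedAlgebra ℚ_[2] K] [IsUltrametricDist K]

omit [IsUltrametricDist K] in
/-- `π² = 2` ⇒ `π` is a root of `X² − 2`. [cite: NeukirchANT1999, Ch. II (5.5)] -/
theorem aeval_X_pow_two_sub_C_eq_zero {π : K} (hπ : π ^ 2 = 2) :
    Polynomial.aeval π (X ^ 2 - C (2 : ℚ_[2])) = 0 := by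
  have h2 : algebraMap ℚ_[2] K 2 = 2 := map_ofNat _ 2
  simp [hπ, h2]

/-- **`[ℚ₂(π) : ℚ₂] = 2`** for `π ∈ K` with `π² = 2`, `K` any ultrametric normed field over `ℚ₂` (`≤`: the minimal polynomial divides
`X² − 2`; `≥`: abc-iut-E-t16's `WildQuadratic.linearIndependent_one_pi` inside the subfield). [cite: NeukirchANT1999, Ch. II (5.5)] -/
theorem finrank_adjoin_sqrt_two {π : K} (hπ : π ^ 2 = 2) :
    Module.finrank ℚ_[2] ℚ_[2]⟮π⟯ = 2 ∧ (⟨π, mem_adjoin_simple_self ℚ_[2] π⟩ : ℚ_[2]⟮π⟯) ^ 2 = 2 := by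
  have heval := aeval_X_pow_two_sub_C_eq_zero hπ
  have hint : IsIntegral ℚ_[2] π := ⟨X ^ 2 - C 2, monic_X_pow_sub_C 2 (by norm_num), by
    simpa [Polynomial.aeval_def] using heval⟩
  haveI hfd : FiniteDimensional ℚ_[2] ℚ_[2]⟮π⟯ := adjoin.finiteDimensional hint
  have hπE : (⟨π, mem_adjoin_simple_self ℚ_[2] π⟩ : ℚ_[2]⟮π⟯) ^ 2 = 2 := by
    apply Subtype.ext
    have h2E : ((2 : ℚ_[2]⟮π⟯) : K) = 2 := map_ofNat (algebraMap ℚ_[2]⟮π⟯ K) 2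
    simp [hπ, h2E]
  refine ⟨le_antisymm ?_ ?_, hπE⟩
  · rw [adjoin.finrank hint]
    have hdvd : minpoly ℚ_[2] π ∣ X ^ 2 - C 2 := minpoly.dvd ℚ_[2] π heval
    have hne : (X ^ 2 - C (2 : ℚ_[2])) ≠ 0 := (monic_X_pow_sub_C 2 (by norm_num)).ne_zero
    calc (minpoly ℚ_[2] π).natDegree ≤ (X ^ 2 - C (2 : ℚ_[2])).natDegree := natDegree_le_of_dvd hdvd hne
      _ = 2 := natDegree_X_pow_sub_C
  · have hli := WildQuadratic.linearIndependent_one_pi (K := ℚ_[2]⟮π⟯) hπE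
    simpa using hli.fintype_card_le_finrank

/-- **WILD DYADIC (QUADRATIC) MOVER WITHOUT DEGREE CONDITION.**  For ANY `2`-adic field `K` (ultrametric, proper) containing `π`
with `π² = 2` there are a `ℚ₂`-linear ISOMETRY `G` of `K` and `z ∈ (R_I)^∼` of `K ⊗_{ℚ₂} K` with `(G ⊗ 1) z ∉ (R_I)^∼`: abc-iut-E-t16's
transvection mover of `ℚ₂(π)` (`WildQuadratic.exists_isometry_maxOrder_mover`) ascends along `ℚ₂(π) ⊆ K`.
[cite: Mochizuki2012, IUTchIV Prop. 1.1 p. 9] [cite: NeukirchANT1999, Ch. II (5.5)] [cite: WeilBNT1967, Ch. II §1, Prop. 2–3] -/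
theorem exists_isometry_maxOrder_mover_of_sqrtTwo [ProperSpace K] {π : K} (hπ : π ^ 2 = 2) :
    ∃ G : K ≃ₗ[ℚ_[2]] K, (∀ x, ‖G x‖ = ‖x‖) ∧ (∀ r : ℝ, G '' closedBall (0 : K) r = closedBall 0 r) ∧
      ∃ z : PacketAlgebra 2 (fun _ : Fin 2 => K),
        z ∈ (normalizedPacket 2 (fun _ : Fin 2 => K) : Set (PacketAlgebra 2 (fun _ : Fin 2 => K))) ∧
          (PiTensorProduct.congr (![G, LinearEquiv.refl ℚ_[2] K] : ∀ _ : Fin 2, K ≃ₗ[ℚ_[2]] K) :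
              PacketAlgebra 2 (fun _ : Fin 2 => K) ≃ₗ[ℚ_[2]] PacketAlgebra 2 (fun _ : Fin 2 => K)) z ∉
            (normalizedPacket 2 (fun _ : Fin 2 => K) : Set (PacketAlgebra 2 (fun _ : Fin 2 => K))) := by
  obtain ⟨hK₀, hπ₀⟩ := finrank_adjoin_sqrt_two hπ
  haveI : FiniteDimensional ℚ_[2] ℚ_[2]⟮π⟯ := Module.finite_of_finrank_eq_succ hK₀
  haveI : ProperSpace ℚ_[2]⟮π⟯ := FiniteDimensional.proper ℚ_[2] ℚ_[2]⟮π⟯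
  obtain ⟨g, hg, -, z, hz, hmv⟩ := WildQuadratic.exists_isometry_maxOrder_mover (K := ℚ_[2]⟮π⟯) hK₀ hπ₀
  obtain ⟨G, hGn, hGball, -, z', hz', hmv'⟩ :=
    exists_isometry_mover_pair_of_subfield 2 (ℚ_[2]⟮π⟯).val g hg hz hmv
  exact ⟨G, hGn, hGball, z', hz', hmv'⟩

end Quadratic

end Literature.IUT.LogVolume

end
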